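import Summits.BirchSwinnertonDyer.BirchSwinnertonDyer.Theorems.GoldfeldAllTwistsTwoConverseTwinAdditiveTwoPrimesTwistSelmerDualPOne
import Summits.BirchSwinnertonDyer.BirchSwinnertonDyer.Theorems.GoldfeldAllTwistsTwoConverseTwinAdditiveTwoPrimesTwistDescent
import Literature.NumberTheory.EllipticCurves.TwistFamilySelmerGroupCardInvarianceProofs
import HarnessLib

set_option linter.dupNamespace false -- namespace `…BirchSwinnertonDyer.BirchSwinnertonDyer…` is the cell's (D-0017 nested layout)
set_option autoImplicit false

/-!
# Twin″ (item 19140), cell C7, TRANCHE C7-3 file F10: `#Ш(W/ℚ)[2] ≤ 2` in rank one for `49a1^{(−2qp)}` from the `(4, 4)` descent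

Cell `bsd-goldfeld`, seat `bsd-goldfeld-s1p-c3x` (gen 12); planner RULING (cccxxxviii) (3) «TRANCHE C7-3 (formula axis)», object F10.
`--supports stmt-BirchSwinnertonDyer-19140` as a HELPER. FACT-FREE: no print binder, no definition, no `sorry` (the rank-one hypothesis is a
binder; on C7 it is the rank axis `analyticRank_eq_one_twoPrimesTwist_betaPOne_of_print`).

On C7 the complete `2`-descent of `E = ⟨0, −42qp, 0, 448q²p², 0⟩` has `(#S, #S′) = (4, 4)` (files F9a/F9b), so T3-D's road (`#S·#S′ ≤ 8 ⇒`
both `φ`-parts of `Ш` vanish `⇒ Ш[2] = 0`, `rank_le_one_and_sha_parts_of_card_mul_le` + Literature `forall_mem_sha_two_smul_eq_zero_of_halfModel`)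
is closed. What the count still gives in rank one: `2^{s+s′} = 2^{r+2}·#Ш(V₀)[φ]·#Ш(E)[φ]` (Literature `two_pow_twoIsogenySelmerRank_add_eq`,
`V₀` the half-model of `E′` with `V₀′ = E`) and `s, s′ ≤ 2`, `r = 1` force `#Ш(V₀)[φ] · #Ш(E)[φ] ≤ 2`; and FUNCTORIALITY ALONE bounds the
`2`-torsion by the two isogeny parts:

  **`#(Ш(V′) ∩ H¹(K,V′)[2]) ≤ #(Ш(V′) ∩ im Ξ_{V′}) · #(Ш(V) ∩ im Ξ_V)`** for every `V` in two-torsion normal form over a number field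
  (§2, `natCard_sha_twoIsogenyCodomain_inf_torsionBy_two_le`): the dual isogeny `φ̂_* : H¹(K, V′) → H¹(K, V)` maps `Ш(V′)[2]` into
  `Ш(V) ∩ ker φ_* = Ш(V) ∩ im Ξ_V` (`φ_* φ̂_* = 2`), with kernel inside `Ш(V′) ∩ ker φ̂_* = Ш(V′) ∩ im Ξ_{V′}`
  (`ker_galH1Map_eq_of_comp_twoIsogeny`, `range_twoIsogenyTorsorHom_eq_ker_galH1Map`), and `#A ≤ #ker · #image` (§1).

Hence (§3) `#S(a,b), #S′(a,b) ≤ 4` and `rank E_{a,b}(ℚ) = 1` ⇒ `#(Ш(E_{a,b}) ∩ H¹[2]) ≤ 2`, and (§4) on C7: **`#(Ш(W/ℚ) ∩ H¹(ℚ,W)[2]) ≤ 2` for every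
elliptic `W` with `C • W = X₀(49)^{(−2qp)}` of rank one** (transport by `natCard_sha_inf_torsionBy_smul`). File F11 adds Cassels–Tate (`#Ш[2]` a
square once `Ш` is finite) to reach `Ш(W)[2] = 0`.
HONEST FRAMING: a bound on `Ш[2]`; no `BSD(W,2)` is proved; BSD is not proved by any of this; item 19140 stays open.

References: [SilvermanAEC2009] Thm. X.4.2(a), Prop. X.4.9, Thm. III.6.1–III.6.2.
-/

noncomputable section

open scoped Classical

open WeierstrassCurve Literature.NumberTheory.EllipticCurves
open _root_.WeierstrassCurve.Affine (SqUnits)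

namespace Summit.BirchSwinnertonDyer.BirchSwinnertonDyer.Theorems.GoldfeldGoodTwists

/-! ## §1 `#A ≤ #kernel · #image` -/

/-- For an additive homomorphism `f` and a subgroup `S`: if `S ∩ ker f ⊆ U` and `f(S) ⊆ T` with `U, T` finite then `#S ≤ #U · #T`.
[folklore] -/
theorem natCard_le_of_inf_ker_le_of_map_le {A B : Type*} [AddCommGroup A] [AddCommGroup B] (f : A →+ B)
    (S U : AddSubgroup A) (T : AddSubgroup B) [Finite U] [Finite T] (hker : S ⊓ f.ker ≤ U) (him : S.map f ≤ T) :
    Nat.card S ≤ Nat.card U * Nat.card T := by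
  set g : S →+ B := f.comp S.subtype with hg
  have h1 : Nat.card S = Nat.card (S ⧸ g.ker) * Nat.card g.ker := AddSubgroup.card_eq_card_quotient_mul_card_addSubgroup g.ker
  rw [Nat.card_congr (QuotientAddGroup.quotientKerEquivRange g).toEquiv] at h1
  have hk : Nat.card g.ker ≤ Nat.card U := by
    refine Nat.card_le_card_of_injective (fun x ↦ ⟨((x : S) : A), hker (AddSubgroup.mem_inf.mpr ⟨(x : S).2, ?_⟩)⟩) ?_
    · have hx : g x = 0 := x.2
      rw [AddMonoidHom.mem_ker]
      simpa [hg] using hx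
    · intro x y h
      exact Subtype.ext (Subtype.ext (by simpa using congrArg Subtype.val h))
  have hr : Nat.card g.range ≤ Nat.card T := by
    refine Nat.card_le_card_of_injective (fun y ↦ ⟨(y : B), ?_⟩) ?_
    · obtain ⟨x, hx⟩ := y.2
      exact him (AddSubgroup.mem_map.mpr ⟨x, x.2, by rw [← hx, hg]; rfl⟩)
    · intro y₁ y₂ h
      exact Subtype.ext (by simpa using congrArg Subtype.val h)
  rw [h1, mul_comm]
  exact Nat.mul_le_mul hk hr

/-! ## §2 `#Ш(V′)[2] ≤ #Ш(V′)[φ̂] · #Ш(V)[φ]` by functoriality -/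

section General

variable {K : Type*} [Field K] [NumberField K] (V : WeierstrassCurve K) [V.IsTwoTorsionNF] [V.IsElliptic]

/-- **`#(Ш(V′) ∩ H¹(K,V′)[2]) ≤ #(Ш(V′) ∩ im Ξ_{V′}) · #(Ш(V) ∩ im Ξ_V)`** (`V′ = V.twoIsogenyCodomain`, both parts finite): the dual
isogeny `φ̂ : V′ → V` (`exists_isogeny_comp_twoIsogeny_eq_two`) induces `φ̂_* : Ш(V′)[2] → Ш(V) ∩ ker φ_* = Ш(V) ∩ im Ξ_V`
(`φ_* φ̂_* c = 2c = 0`; `galH1Map_mem_sha`, `galH1Map_galH1Map_of_comp_eq_nsmul`, `range_twoIsogenyTorsorHom_eq_ker_galH1Map`) whose kernel lies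
in `Ш(V′) ∩ ker φ̂_* = Ш(V′) ∩ ker (φ_{V′})_* = Ш(V′) ∩ im Ξ_{V′}` (`ker_galH1Map_eq_of_comp_twoIsogeny`).
[cite: SilvermanAEC2009, Thm. X.4.2(a) and Thm. III.6.2(a)] -/
theorem natCard_sha_twoIsogenyCodomain_inf_torsionBy_two_le
    (hV : Finite ↥(V.sha ⊓ AddMonoidHom.range (G := Additive (SqUnits K)) V.twoIsogenyTorsorHom))
    (hV' : Finite ↥(V.twoIsogenyCodomain.sha ⊓
      AddMonoidHom.range (G := Additive (SqUnits K)) V.twoIsogenyCodomain.twoIsogenyTorsorHom)) :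
    Nat.card ↥(V.twoIsogenyCodomain.sha ⊓ AddSubgroup.torsionBy V.twoIsogenyCodomain.galH1 2) ≤
      Nat.card ↥(V.twoIsogenyCodomain.sha ⊓
          AddMonoidHom.range (G := Additive (SqUnits K)) V.twoIsogenyCodomain.twoIsogenyTorsorHom) *
        Nat.card ↥(V.sha ⊓ AddMonoidHom.range (G := Additive (SqUnits K)) V.twoIsogenyTorsorHom) := by
  obtain ⟨ψ, hψφ, hφψ⟩ := V.exists_isogeny_comp_twoIsogeny_eq_two
  haveI := hV
  haveI := hV'
  refine natCard_le_of_inf_ker_le_of_map_le (galH1Map ψ.toAddMonoidHom ψ.equivariant) _ _ _ ?_ ?_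
  · -- the kernel: `Ш(V′) ∩ ker φ̂_* = Ш(V′) ∩ im Ξ_{V′}`
    rintro c ⟨⟨hc, -⟩, hk⟩
    refine AddSubgroup.mem_inf.mpr ⟨hc, ?_⟩
    rw [range_twoIsogenyTorsorHom_eq_ker_galH1Map,
      ← ker_galH1Map_eq_of_comp_twoIsogeny ψ.toAddMonoidHom ψ.equivariant (fun P ↦ ?_)]
    · exact hk
    · rw [hψφ, ← natCast_zsmul]
  · -- the image: `φ̂_* c ∈ Ш(V)`, and `φ_* (φ̂_* c) = 2c = 0`
    rintro _ ⟨c, hc, rfl⟩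
    obtain ⟨hcsha, hctor⟩ := AddSubgroup.mem_inf.mp hc
    have h2 : 2 • c = 0 := (AddSubgroup.torsionBy.nsmul_iff (n := 2)).mp hctor
    refine AddSubgroup.mem_inf.mpr
      ⟨galH1Map_mem_sha ψ.toAddMonoidHom ψ.equivariant ψ.hasLocalPointsMaps_toAddMonoidHom hcsha, ?_⟩
    rw [range_twoIsogenyTorsorHom_eq_ker_galH1Map, AddMonoidHom.mem_ker,
      galH1Map_galH1Map_of_comp_eq_nsmul ψ.toAddMonoidHom ψ.equivariant V.twoIsogenyGeomHom (twoIsogenyGeomHom_smul V) hφψ c,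
      h2]

end General

/-! ## §3 Over `ℚ`: `#S, #S′ ≤ 4` and rank one ⇒ `#Ш(E_{a,b})[2] ≤ 2` -/

/-- **`#S(a,b) ≤ 4`, `#S′(a,b) ≤ 4`, `rank E_{a,b}(ℚ) = 1` ⇒ `#(Ш(E_{a,b}/ℚ) ∩ H¹[2]) ≤ 2`.** The count `2^{s+s′} = 2^{r+2}·#Ш(V₀)[φ]·#Ш(E)[φ]`
(`two_pow_twoIsogenySelmerRank_add_eq`, `V₀` the half-model of `E′`, `V₀′ = E` by `twoIsogenyCodomain_halfModel`) leaves `#Ш(V₀)[φ]·#Ш(E)[φ] ≤ 2`,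
and §2 for `V = V₀`. [cite: SilvermanAEC2009, Thm. X.4.2(a) and Prop. X.4.9] -/
theorem natCard_sha_inf_torsionBy_two_le_two_of_card_le_four {a b : ℤ} (hab : b * (a ^ 2 - 4 * b) ≠ 0)
    [hV₀ : (⟨0, -(a : ℚ) / 2, 0, ((a : ℚ) ^ 2 - 4 * b) / 16, 0⟩ : WeierstrassCurve ℚ).IsElliptic]
    [hE : (⟨0, (a : ℚ), 0, (b : ℚ), 0⟩ : WeierstrassCurve ℚ).IsElliptic]
    (hS : (twoIsogenySelmerGroup a b).card ≤ 4) (hS' : (twoIsogenySelmerGroup' a b).card ≤ 4)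
    (hrk : (⟨0, (a : ℚ), 0, (b : ℚ), 0⟩ : WeierstrassCurve ℚ).mordellWeilRank = 1) :
    Nat.card ↥((⟨0, (a : ℚ), 0, (b : ℚ), 0⟩ : WeierstrassCurve ℚ).sha ⊓
      AddSubgroup.torsionBy (⟨0, (a : ℚ), 0, (b : ℚ), 0⟩ : WeierstrassCurve ℚ).galH1 2) ≤ 2 := by
  set V₀ : WeierstrassCurve ℚ := ⟨0, -(a : ℚ) / 2, 0, ((a : ℚ) ^ 2 - 4 * b) / 16, 0⟩ with hV₀def
  set E : WeierstrassCurve ℚ := ⟨0, (a : ℚ), 0, (b : ℚ), 0⟩ with hEdef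
  have key := two_pow_twoIsogenySelmerRank_add_eq hab (hV₀ := hV₀) (hE := hE)
  have hle : 2 ^ (twoIsogenySelmerRank a b + twoIsogenySelmerRank' a b) ≤ 16 := by
    rw [pow_add, two_pow_twoIsogenySelmerRank_eq_card hab, two_pow_twoIsogenySelmerRank'_eq_card hab]
    exact Nat.mul_le_mul hS hS'
  rw [key, hrk] at hle
  set n₁ := Nat.card ↥(V₀.sha ⊓ V₀.twoIsogenyTorsorHom.range) with hn₁
  set n₂ := Nat.card ↥(E.sha ⊓ E.twoIsogenyTorsorHom.range) with hn₂
  have hn : n₁ * n₂ ≤ 2 := by norm_num at hle; omega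
  have hn0 : n₁ * n₂ ≠ 0 := by
    intro h0
    have h2 : (2 : ℕ) ^ (twoIsogenySelmerRank a b + twoIsogenySelmerRank' a b) ≠ 0 := pow_ne_zero _ two_ne_zero
    rw [key, h0, mul_zero] at h2
    exact h2 rfl
  haveI hf₁ : Finite ↥(V₀.sha ⊓ V₀.twoIsogenyTorsorHom.range) := Nat.finite_of_card_ne_zero (left_ne_zero_of_mul hn0)
  have hE' : V₀.twoIsogenyCodomain = E := twoIsogenyCodomain_halfModel a b
  -- transport along `V₀′ = E` (the instances are propositions)
  have transfer : ∀ {W₁ W₂ : WeierstrassCurve ℚ} (_ : W₁ = W₂) [W₁.IsTwoTorsionNF] [W₁.IsElliptic]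
      [W₂.IsTwoTorsionNF] [W₂.IsElliptic],
      Nat.card ↥(W₁.sha ⊓ AddSubgroup.torsionBy W₁.galH1 2) = Nat.card ↥(W₂.sha ⊓ AddSubgroup.torsionBy W₂.galH1 2) ∧
        Nat.card ↥(W₁.sha ⊓ W₁.twoIsogenyTorsorHom.range) = Nat.card ↥(W₂.sha ⊓ W₂.twoIsogenyTorsorHom.range) := by
    intro W₁ W₂ h _ _ _ _
    subst h
    exact ⟨rfl, rfl⟩
  obtain ⟨ht, hr⟩ := transfer hE'
  have hf₂ : Finite ↥(V₀.twoIsogenyCodomain.sha ⊓ V₀.twoIsogenyCodomain.twoIsogenyTorsorHom.range) := by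
    apply Nat.finite_of_card_ne_zero
    rw [hr]
    exact right_ne_zero_of_mul hn0
  have main := natCard_sha_twoIsogenyCodomain_inf_torsionBy_two_le V₀ hf₁ hf₂
  rw [ht, hr] at main
  calc _ ≤ n₂ * n₁ := main
    _ = n₁ * n₂ := mul_comm _ _
    _ ≤ 2 := hn

/-- Transport of rank and of `#(Ш ∩ H¹[2])` from `W` to a model `E = C′ • W` (`mordellWeilRank_variableChange_holds`,
`natCard_sha_inf_torsionBy_smul`). [cite: SilvermanAEC2009, X.§4 and III.3.1(b)] -/
theorem rank_and_natCard_sha_two_of_smul_eq (W E : WeierstrassCurve ℚ) [W.IsElliptic] [E.IsElliptic] (C' : VariableChange ℚ)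
    (hE : C' • W = E) :
    E.mordellWeilRank = W.mordellWeilRank ∧
      Nat.card ↥(E.sha ⊓ AddSubgroup.torsionBy E.galH1 2) = Nat.card ↥(W.sha ⊓ AddSubgroup.torsionBy W.galH1 2) := by
  subst hE
  refine ⟨?_, natCard_sha_inf_torsionBy_smul W C' 2⟩
  have h := mordellWeilRank_variableChange_holds W C'
  unfold mordellWeilRank_variableChange at h
  convert h using 2

/-! ## §4 Cell C7: `#Ш(W)[2] ≤ 2` in rank one for every model of `49a1^{(−2qp)}` -/

section C7
variable {q p : ℕ} [Fact q.Prime] [Fact p.Prime]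

/-- **`#(Ш(E) ∩ H¹[2]) ≤ 2` for T3-D's model `E = ⟨0, −42qp, 0, 448q²p², 0⟩` on C7 in rank one** (F9a/F9b's `(4, 4)` and §3).
[cite: SilvermanAEC2009, Thm. X.4.2(a) and Prop. X.4.9] -/
theorem natCard_sha_two_le_two_twoTorsionModel_twoPrimesTwist_pOne (hq8 : q % 8 = 7) (hq7 : jacobiSym q 7 = -1) (hp8 : p % 8 = 1)
    (hp7 : legendreSym p (-7) = 1) (hβ : ∃ x : ZMod p, x ^ 4 = -7) (hpq : jacobiSym p q = -1)
    [hE : (⟨0, ((-42 * ((q : ℤ) * p) : ℤ) : ℚ), 0, ((448 * ((q : ℤ) * p) ^ 2 : ℤ) : ℚ), 0⟩ : WeierstrassCurve ℚ).IsElliptic]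
    (hrk : (⟨0, ((-42 * ((q : ℤ) * p) : ℤ) : ℚ), 0, ((448 * ((q : ℤ) * p) ^ 2 : ℤ) : ℚ), 0⟩ : WeierstrassCurve ℚ).mordellWeilRank = 1) :
    Nat.card ↥((⟨0, ((-42 * ((q : ℤ) * p) : ℤ) : ℚ), 0, ((448 * ((q : ℤ) * p) ^ 2 : ℤ) : ℚ), 0⟩ : WeierstrassCurve ℚ).sha ⊓
      AddSubgroup.torsionBy (⟨0, ((-42 * ((q : ℤ) * p) : ℤ) : ℚ), 0, ((448 * ((q : ℤ) * p) ^ 2 : ℤ) : ℚ), 0⟩ :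
        WeierstrassCurve ℚ).galH1 2) ≤ 2 := by
  have hq : q.Prime := Fact.out
  have hp : p.Prime := Fact.out
  have hab := hab_inertTwoTwist (m := q * p) (Nat.mul_pos hq.pos hp.pos)
  push_cast at hab
  haveI := isElliptic_halfModel hab
  exact natCard_sha_inf_torsionBy_two_le_two_of_card_le_four hab
    (card_twoIsogenySelmerGroup_twoPrimesTwist_le_four_pOne hq8 hq7 (by omega) hp7 hpq)
    (card_twoIsogenySelmerGroup'_twoPrimesTwist_le_four_pOne hq8 hq7 hp8 hp7 hβ hpq) hrk

/-- **`#(Ш(W/ℚ) ∩ H¹(ℚ,W)[2]) ≤ 2` for EVERY elliptic `W` with `C • W = X₀(49)^{(−2qp)}` on C7 of rank one** (UNCONDITIONAL given the rank;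
on C7 the rank is the rank axis `analyticRank_eq_one_twoPrimesTwist_betaPOne_of_print`). [cite: SilvermanAEC2009, Thm. X.4.2(a), Prop. X.4.9 and X.§4] -/
theorem natCard_sha_two_le_two_twoPrimesTwist_pOne (hq8 : q % 8 = 7) (hq7 : jacobiSym q 7 = -1) (hp8 : p % 8 = 1)
    (hp7 : legendreSym p (-7) = 1) (hβ : ∃ x : ZMod p, x ^ 4 = -7) (hpq : jacobiSym p q = -1)
    (W : WeierstrassCurve ℚ) [W.IsElliptic] (C : VariableChange ℚ)
    (hC : C • W = cm7.quadraticTwist ((-2 * ((q : ℤ) * p) : ℤ) : ℚ)) (hrk : W.mordellWeilRank = 1) :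
    Nat.card ↥(W.sha ⊓ AddSubgroup.torsionBy W.galH1 2) ≤ 2 := by
  have hq : q.Prime := Fact.out
  have hp : p.Prime := Fact.out
  have hab := hab_inertTwoTwist (m := q * p) (Nat.mul_pos hq.pos hp.pos)
  push_cast at hab
  haveI := isElliptic_mk_of_ne_zero (F := ℚ) hab
  have hE := (smul_eq_twoTorsionModel_of_smul_eq_quadraticTwist (-2 * ((q : ℤ) * p)) W C hC).trans
    (show (⟨0, ((21 * (-2 * ((q : ℤ) * p)) : ℤ) : ℚ), 0, ((112 * (-2 * ((q : ℤ) * p)) ^ 2 : ℤ) : ℚ), 0⟩ :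
        WeierstrassCurve ℚ) = ⟨0, ((-42 * ((q : ℤ) * p) : ℤ) : ℚ), 0, ((448 * ((q : ℤ) * p) ^ 2 : ℤ) : ℚ), 0⟩ by
      ext <;> push_cast <;> ring)
  obtain ⟨hr, hc⟩ := rank_and_natCard_sha_two_of_smul_eq W _ _ hE
  rw [← hc]
  exact natCard_sha_two_le_two_twoTorsionModel_twoPrimesTwist_pOne hq8 hq7 hp8 hp7 hβ hpq (hr.trans hrk)

end C7

end Summit.BirchSwinnertonDyer.BirchSwinnertonDyer.Theorems.GoldfeldGoodTwists

end
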